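import Summits.KontsevichZagierPeriods.Zeta5Search.Barrier.ConeGammaLogCuspUniform
import Summits.KontsevichZagierPeriods.Zeta5Search.Barrier.ConeGammaRegularCusp

/-!
# ζ(5) search — BARRIER: `γ`'s LOG-CUSP EXPANSION IS UNIFORM ON THE COHERENCE BALL — one constant, one radius; unconditionally at Regular directions

HONEST FRAMING (cell `pub-zeta5`): systematic search; no irrationality claim unless kernel-certified. MODEL objects
under Brown–Zudilin's (28)+(30) accounting ([BZ22] = arXiv:2210.03391; (28) observed, not proved): the rate function
`γ = (C₁ − C₀)/(C₁ + δ₂₈ − Φ)` of `ConeGammaRates` near a rational direction. Nothing here is a statement about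
`ζ(5)`, any `γ` OF RECORD (no named direction enters a statement), the cone's supremum (C2 = `BarrierC2`, OPEN) or
the value / sign of the cusp slope at a named direction (DATA of the cell); the lemma S-E stays CONJECTURED, and every
ball below is Lemma B's COHERENCE ball, not S-E's covering ball of radius `1/(2λ₀)`; records in print UNMOVED.
Prover P2 g38 (P2 g37's successor menu (a) «`γ` inherits the local maximum — make the Lipschitz hypothesis of
`gamma_logCusp_of_lipschitz_cuspSlope` uniform in the direction exactly as (B)–(D) did for `Φ`»), file (1) of three
(theorems only).

THE POINT. P2 g37 (`ConeGammaLogCuspUniform`) put the log-cusp expansion of the MODEL saving `Φ` on a whole `Y`-ball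
(`Y(η) = max_k |φ_k(η)|`) with ONE constant. P2 g19's `gamma_logCusp_of_lipschitz` transported the RAY expansion to
`γ` under a Lipschitz hypothesis on `C₁`, `C₀` along the ray, and P2 g23's `regular_stable` DISCHARGED that
hypothesis at every Regular open-box direction — UNIFORMLY: one radius, one constant, in the sup norm of the symmetric
coordinates. Putting the three together:
* `abs_delta28_sub_le_shiftSize` — `|δ₂₈(s(a)+η) − δ₂₈(a)| ≤ 25·Y(η)` (the tree's `abs_delta28_sub_le_sParam` in the
  form-size gauge, `|η_i| ≤ (5/2)·Y(η)`);
* **`gamma_logCusp_nhds_of_lipschitz`** — THE NEIGHBOURHOOD FORM OF `γ`'S LOG-CUSP, CONDITIONAL: all 28 forms of `a`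
  positive, `a` in the closed box, `T` a period, `Q = C₁ + δ₂₈ − Φ > 0` at `a`, and `C₁`, `C₀` CALM at `a` in the
  form-size gauge (`|C_i(s(a)+η) − C_i(a)| ≤ L·Y(η)` for `Y(η) ≤ r₀` — a HYPOTHESIS here): there are `C′` and `r > 0`
  with **`|γ(s(a)+η) − γ(a) − ((C₁−C₀)/Q²)·(σ(η)/T)·log(1/Y(η))| ≤ C′·Y(η)`** for EVERY displacement `η` with
  `0 < Y(η) ≤ r` and `s(a)+η` in the closed box (`σ = cuspSlope a T`). The algebra is that of P2 g19's
  `gamma_logCusp_of_lipschitz` (`abs_div_perturb_sub_le`), fed with the BALL expansion `phi30_logCusp_nhds` and the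
  uniform slope bound `|σ(η)| ≤ 28·T·Y(η)` instead of the ray data — so the constant no longer depends on the
  displacement;
* `exists_calm_C1_C0_of_regular` — P2 g23's `regular_stable` in the form-size gauge: at a Regular open-box direction
  `C₁`, `C₀` ARE calm at `a` (`‖η‖ ≤ (5/2)·Y(η)`, `norm_le_shiftSize`);
* **`gamma_logCusp_nhds_of_regular`** — THE NEIGHBOURHOOD FORM, UNCONDITIONALLY AT REGULAR DIRECTIONS: at a Regular
  open-box direction with `Q > 0`, for every period `T`, there are `C′`, `r > 0` with
  `|γ(s(a)+η) − γ(a) − ((C₁−C₀)/Q²)·(σ(η)/T)·log(1/Y(η))| ≤ C′·Y(η)` for EVERY `η` with `0 < Y(η) ≤ r` (no side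
  condition: the open box absorbs the displacement, `BZBox_perturb_of_shiftSize_le`). So on the whole `Y`-ball the
  MODEL rate function is its value at the rational direction plus the cusp term with the EXACT coefficient
  `(∂γ/∂Φ)·σ(η)/T`, `∂γ/∂Φ = (C₁−C₀)/Q² > 0` (`C0_lt_C1_of_regular`), up to `O(Y(η))` with ONE constant;
* `abs_gamma_sub_le_of_regular` — hence `|γ(s(a)+η) − γ(a)| ≤ K·Y(η)·log(1/Y(η)) + C′·Y(η)` on that ball: `γ` is
  continuous at `a` with an `Y·log(1/Y)` modulus in the form gauge (P2 g23's `continuousAt_gamma_of_regular`, now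
  quantitative on the coherence ball).
NOT here (honest): the radius is Lemma B's COHERENCE radius intersected with g23's stability radius — this ball is NOT
S-E's covering ball and S-E stays CONJECTURED; no radius, constant, value or sign of `σ` at a named direction enters a
statement; the closed-box faces and the loss loci (where `Regular` fails) are not covered by the unconditional form;
nothing about C2 or `ζ(5)`. File (2) (`ConeGammaGammaModulusLocal`) reads this expansion through P2 g36's modulus `Λ`.
-/

noncomputable section

open Set MeasureTheory
open scoped Topology

namespace Summit.KontsevichZagierPeriods.Zeta5Search.Barrier.ConeGamma

/-! ### The data of `γ`'s denominator on a `Y`-ball -/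

/-- **`δ₂₈` is Lipschitz in the form-size gauge**: `|δ₂₈(aOfS(s(a)+η)) − δ₂₈(a)| ≤ 25·Y(η)` (the tree's
`abs_delta28_sub_le_sParam`, constant `10`, with `|η₀| ≤ (3/2)·Y(η)` and `|η_{j+1}| ≤ (5/2)·Y(η)`). -/
theorem abs_delta28_sub_le_shiftSize (a : Dir) (η : Fin 8 → ℝ) :
    |delta28 (aOfS (sParam a + η)) - delta28 a| ≤ 25 * shiftSize η := by
  have h : ∀ i : Fin 8, |sParam (aOfS (sParam a + η)) i - sParam a i| ≤ 5 / 2 * shiftSize η := by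
    intro i
    rw [sParam_aOfS, Pi.add_apply, add_sub_cancel_left]
    refine Fin.cases ?_ (fun j => abs_apply_succ_le_shiftSize η j) i
    have := shiftSize_nonneg η
    linarith [abs_apply_zero_le_shiftSize η]
  have := abs_delta28_sub_le_sParam h
  linarith

/-! ### `γ`'s log-cusp on a ball — conditional on calm `C₁`, `C₀` -/

/-- **THE NEIGHBOURHOOD FORM OF `γ`'S LOG-CUSP (conditional).** All 28 forms of `a` positive, `a` in the closed box,
`T > 0` a period, `Q = C₁ + δ₂₈ − Φ > 0` at `a`, and — A HYPOTHESIS — `C₁`, `C₀` calm at `a` in the form-size gauge: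
`|C₁(aOfS(s(a)+η)) − C₁(a)| ≤ L·Y(η)` and the same for `C₀`, for every `η` with `Y(η) ≤ r₀` (at a Regular open-box
direction this is P2 g23's `regular_stable`, see `exists_calm_C1_C0_of_regular`; on the loss loci nothing is claimed).
Then there are `C′` and `r > 0` such that for EVERY displacement `η` with `0 < Y(η) ≤ r` and `s(a)+η` in the closed
box: `|γ(s(a)+η) − γ(a) − ((C₁−C₀)/Q²)·(cuspSlope a T η / T)·log(1/Y(η))| ≤ C′·Y(η)`.
(The proof follows the algebra of P2 g19's `gamma_logCusp_of_lipschitz` step for step — `abs_div_perturb_sub_le`, the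
`√Y` device — with the ball data of `phi30_logCusp_nhds` (`|σ(η)| ≤ 28·T·Y(η)`, `|Δδ₂₈| ≤ 25·Y(η)`) in place of the
ray data: a new statement, not a re-run of an accepted proof. The radius is at most Lemma B's coherence radius — this
ball is Lemma B's coherence ball, not S-E's covering ball; S-E stays CONJECTURED.) -/
theorem gamma_logCusp_nhds_of_lipschitz {a : Dir} (ha : BZBox a) (hpos : ∀ k, 0 < h28 a k) {T : ℝ} (hT : 0 < T)
    (hper : ∀ k : Fin 28, ∃ z : ℤ, T * h28 a k = z) (hQ : 0 < C1 a + delta28 a - phi30 a)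
    {L r₀ : ℝ} (hL : 0 ≤ L) (hr₀ : 0 < r₀)
    (hC1 : ∀ η : Fin 8 → ℝ, shiftSize η ≤ r₀ → |C1 (aOfS (sParam a + η)) - C1 a| ≤ L * shiftSize η)
    (hC0 : ∀ η : Fin 8 → ℝ, shiftSize η ≤ r₀ → |C0 (aOfS (sParam a + η)) - C0 a| ≤ L * shiftSize η) :
    ∃ C' r : ℝ, 0 < r ∧ ∀ η : Fin 8 → ℝ, 0 < shiftSize η → shiftSize η ≤ r →
      BZBox (aOfS (sParam a + η)) →
        |gamma (aOfS (sParam a + η)) - gamma a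
          - (C1 a - C0 a) / (C1 a + delta28 a - phi30 a) ^ 2 * (cuspSlope a T η / T)
            * Real.log (1 / shiftSize η)| ≤ C' * shiftSize η := by
  obtain ⟨C, r, hr, hexp⟩ := phi30_logCusp_nhds ha hpos hT hper
  -- names for the numerator and the denominator at `a`
  obtain ⟨N, hN⟩ : ∃ N : ℝ, N = C1 a - C0 a := ⟨_, rfl⟩
  obtain ⟨Q, hQdef⟩ : ∃ Q : ℝ, Q = C1 a + delta28 a - phi30 a := ⟨_, rfl⟩
  rw [← hQdef] at hQ
  rw [← hN, ← hQdef]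
  -- the constants
  obtain ⟨B, hB⟩ : ∃ B : ℝ, B = L + 25 + |C| := ⟨_, rfl⟩
  have hB0 : 0 ≤ B := by rw [hB]; positivity
  obtain ⟨A, hA⟩ : ∃ A : ℝ, A = 56 + B := ⟨_, rfl⟩
  have hA0 : 0 ≤ A := by rw [hA]; linarith
  obtain ⟨C', hC'⟩ : ∃ C' : ℝ,
      C' = 2 * |N| * (3136 + 56 * B) / Q ^ 3 + 2 * (2 * L * Q + |N| * B) / Q ^ 2 := ⟨_, rfl⟩
  refine ⟨C', min (min r r₀) (min 1 ((Q / (2 * A + 1)) ^ 2)),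
    lt_min (lt_min hr hr₀) (lt_min one_pos (by positivity)), fun η hY hYle hbox => ?_⟩
  have hYr : shiftSize η ≤ r := hYle.trans ((min_le_left _ _).trans (min_le_left _ _))
  have hYr₀ : shiftSize η ≤ r₀ := hYle.trans ((min_le_left _ _).trans (min_le_right _ _))
  have hY1 : shiftSize η ≤ 1 := hYle.trans ((min_le_right _ _).trans (min_le_left _ _))
  have hYsq : shiftSize η ≤ (Q / (2 * A + 1)) ^ 2 :=
    hYle.trans ((min_le_right _ _).trans (min_le_right _ _))
  -- the instantiated data; then name `Y = Y(η)`, the displaced direction and the perturbations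
  have hΦ := hexp η hY hYr hbox
  have h1 := hC1 η hYr₀
  have h0 := hC0 η hYr₀
  have hδ := abs_delta28_sub_le_shiftSize a η
  have hσ := abs_cuspSlope_le_shiftSize hpos hT hper η
  obtain ⟨Y, hYdef⟩ : ∃ Y : ℝ, Y = shiftSize η := ⟨_, rfl⟩
  rw [← hYdef] at hY hY1 hYsq hΦ h1 h0 hδ hσ ⊢
  obtain ⟨a', ha'⟩ : ∃ a' : Dir, a' = aOfS (sParam a + η) := ⟨_, rfl⟩
  rw [← ha'] at hΦ h1 h0 hδ ⊢
  obtain ⟨σ, hσdef⟩ : ∃ σ : ℝ, σ = cuspSlope a T η := ⟨_, rfl⟩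
  rw [← hσdef] at hΦ hσ ⊢
  obtain ⟨ΔC1, hΔC1⟩ : ∃ x : ℝ, x = C1 a' - C1 a := ⟨_, rfl⟩
  obtain ⟨ΔC0, hΔC0⟩ : ∃ x : ℝ, x = C0 a' - C0 a := ⟨_, rfl⟩
  obtain ⟨Δδ, hΔδ⟩ : ∃ x : ℝ, x = delta28 a' - delta28 a := ⟨_, rfl⟩
  rw [← hΔC1] at h1
  rw [← hΔC0] at h0
  rw [← hΔδ] at hδ
  obtain ⟨Λ, hΛ⟩ : ∃ x : ℝ, x = Real.log (1 / Y) := ⟨_, rfl⟩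
  rw [← hΛ] at hΦ ⊢
  obtain ⟨m, hm⟩ : ∃ x : ℝ, x = σ / T * Λ := ⟨_, rfl⟩
  rw [← hm] at hΦ
  obtain ⟨r', hr'⟩ : ∃ x : ℝ, x = phi30 a' - phi30 a - m := ⟨_, rfl⟩
  rw [← hr'] at hΦ
  have hbr : |r'| ≤ |C| * Y := hΦ.trans (mul_le_mul_of_nonneg_right (le_abs_self C) hY.le)
  -- elementary facts on `Y` and `Λ = log(1/Y)`
  have hΛ0 : 0 ≤ Λ := by rw [hΛ]; exact Real.log_nonneg (by rw [le_div_iff₀ hY]; linarith)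
  have hYΛ : Y * Λ ≤ 2 * Real.sqrt Y := by rw [hΛ]; exact mul_log_inv_le_two_sqrt hY
  have hYΛ2 : Y * Λ ^ 2 ≤ 4 := by rw [hΛ]; exact mul_log_inv_sq_le_four hY hY1
  have hsqrt1 : Real.sqrt Y ≤ 1 := by rw [← Real.sqrt_one]; exact Real.sqrt_le_sqrt hY1
  have hsqrtQ : Real.sqrt Y ≤ Q / (2 * A + 1) := by
    rw [← Real.sqrt_sq (show 0 ≤ Q / (2 * A + 1) by positivity)]; exact Real.sqrt_le_sqrt hYsq
  have hYsqrt : Y ≤ Real.sqrt Y := by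
    calc Y = Real.sqrt Y * Real.sqrt Y := (Real.mul_self_sqrt hY.le).symm
      _ ≤ Real.sqrt Y * 1 := mul_le_mul_of_nonneg_left hsqrt1 (Real.sqrt_nonneg _)
      _ = Real.sqrt Y := mul_one _
  have hu2 : Y * Λ ≤ 2 := hYΛ.trans (by linarith)
  -- the cusp term `m = (σ/T)·Λ` has `|m| ≤ 28·Y·Λ`
  have habsm : |m| ≤ 28 * (Y * Λ) := by
    rw [hm, abs_mul, abs_div, abs_of_pos hT, abs_of_nonneg hΛ0]
    have h28 : |σ| / T ≤ 28 * Y := by rw [div_le_iff₀ hT]; linarith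
    calc |σ| / T * Λ ≤ 28 * Y * Λ := mul_le_mul_of_nonneg_right h28 hΛ0
      _ = 28 * (Y * Λ) := by ring
  have hm0 : 0 ≤ |m| := abs_nonneg m
  -- the quotient data: `ΔQ = −m + (ΔC₁ + Δδ − r′)`, `|ΔQ| ≤ A√Y ≤ Q/2`
  have hΔQsplit : ΔC1 + Δδ - (phi30 a' - phi30 a) = -m + (ΔC1 + Δδ - r') := by rw [hr']; ring
  have hrb : |ΔC1 + Δδ - r'| ≤ B * Y := by
    calc |ΔC1 + Δδ - r'| ≤ |ΔC1 + Δδ| + |r'| := abs_sub _ _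
      _ ≤ |ΔC1| + |Δδ| + |r'| := add_le_add (abs_add_le _ _) le_rfl
      _ ≤ L * Y + 25 * Y + |C| * Y := add_le_add (add_le_add h1 hδ) hbr
      _ = B * Y := by rw [hB]; ring
  have hΔQb : |ΔC1 + Δδ - (phi30 a' - phi30 a)| ≤ A * Real.sqrt Y := by
    rw [hΔQsplit]
    calc |-m + (ΔC1 + Δδ - r')| ≤ |-m| + |ΔC1 + Δδ - r'| := abs_add_le _ _
      _ = |m| + |ΔC1 + Δδ - r'| := by rw [abs_neg]
      _ ≤ 28 * (2 * Real.sqrt Y) + B * Real.sqrt Y :=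
          add_le_add (habsm.trans (by linarith)) (hrb.trans (mul_le_mul_of_nonneg_left hYsqrt hB0))
      _ = A * Real.sqrt Y := by rw [hA]; ring
  have hΔQhalf : |ΔC1 + Δδ - (phi30 a' - phi30 a)| ≤ Q / 2 := by
    refine hΔQb.trans ?_
    have hAq : A * (Q / (2 * A + 1)) ≤ Q / 2 := by
      rw [mul_div_assoc', div_le_div_iff₀ (by linarith) two_pos]; nlinarith
    exact (mul_le_mul_of_nonneg_left hsqrtQ hA0).trans hAq
  -- `γ` in terms of the perturbations
  have hγ : gamma a' - gamma a - N / Q ^ 2 * (σ / T) * Λ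
      = (N + (ΔC1 - ΔC0)) / (Q + (ΔC1 + Δδ - (phi30 a' - phi30 a))) - N / Q - N / Q ^ 2 * m := by
    unfold gamma
    rw [hm]
    have e1 : C1 a' - C0 a' = N + (ΔC1 - ΔC0) := by rw [hN, hΔC1, hΔC0]; ring
    have e2 : C1 a' + delta28 a' - phi30 a' = Q + (ΔC1 + Δδ - (phi30 a' - phi30 a)) := by
      rw [hQdef, hΔC1, hΔδ]; ring
    rw [e1, e2, ← hN, ← hQdef]; ring
  rw [hγ]
  refine (abs_div_perturb_sub_le hQ hΔQhalf hΔQsplit).trans ?_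
  -- bound the two terms
  have hΔN : |ΔC1 - ΔC0| ≤ 2 * L * Y := by
    calc |ΔC1 - ΔC0| ≤ |ΔC1| + |ΔC0| := abs_sub _ _
      _ ≤ L * Y + L * Y := add_le_add h1 h0
      _ = 2 * L * Y := by ring
  have hm2 : |m| * |m| ≤ 3136 * Y := by
    have h' : |m| * |m| ≤ (28 * (Y * Λ)) * (28 * (Y * Λ)) := mul_le_mul habsm habsm hm0 (by positivity)
    have e : (28 * (Y * Λ)) * (28 * (Y * Λ)) = 784 * Y * (Y * Λ ^ 2) := by ring
    rw [e] at h'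
    have := mul_le_mul_of_nonneg_left hYΛ2 (show 0 ≤ 784 * Y by positivity)
    linarith
  have hm1 : |m| * (B * Y) ≤ 56 * (B * Y) :=
    mul_le_mul_of_nonneg_right (habsm.trans (by linarith)) (mul_nonneg hB0 hY.le)
  have hmΔQ : |m| * |ΔC1 + Δδ - (phi30 a' - phi30 a)| ≤ Y * (3136 + 56 * B) := by
    rw [hΔQsplit]
    have h' : |-m + (ΔC1 + Δδ - r')| ≤ |m| + B * Y := by
      calc _ ≤ |-m| + |ΔC1 + Δδ - r'| := abs_add_le _ _
        _ ≤ |m| + B * Y := by rw [abs_neg]; exact add_le_add le_rfl hrb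
    calc |m| * |-m + (ΔC1 + Δδ - r')| ≤ |m| * (|m| + B * Y) := mul_le_mul_of_nonneg_left h' hm0
      _ = |m| * |m| + |m| * (B * Y) := by ring
      _ ≤ 3136 * Y + 56 * (B * Y) := add_le_add hm2 hm1
      _ = Y * (3136 + 56 * B) := by ring
  have hN0 : 0 ≤ |N| := abs_nonneg N
  have hQ2 : 0 < Q ^ 2 := pow_pos hQ 2
  have hQ3 : 0 < Q ^ 3 := pow_pos hQ 3
  calc 2 * |N| * |m| * |ΔC1 + Δδ - (phi30 a' - phi30 a)| / Q ^ 3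
        + 2 * (|ΔC1 - ΔC0| * Q + |N| * |ΔC1 + Δδ - r'|) / Q ^ 2
      ≤ 2 * |N| * (Y * (3136 + 56 * B)) / Q ^ 3
        + 2 * (2 * L * Y * Q + |N| * (B * Y)) / Q ^ 2 := by
        refine add_le_add ?_ ?_
        · refine div_le_div_of_nonneg_right ?_ hQ3.le
          rw [mul_assoc (2 * |N|)]
          exact mul_le_mul_of_nonneg_left hmΔQ (by positivity)
        · exact div_le_div_of_nonneg_right (mul_le_mul_of_nonneg_left (add_le_add
            (mul_le_mul_of_nonneg_right hΔN hQ.le) (mul_le_mul_of_nonneg_left hrb hN0)) (by norm_num)) hQ2.le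
    _ = C' * Y := by rw [hC']; field_simp

/-! ### At a Regular open-box direction `C₁`, `C₀` ARE calm — unconditionally -/

/-- **P2 g23's `regular_stable` in the form-size gauge.** At a Regular open-box direction there are `L ≥ 0`, `r₀ > 0`
with `|C₁(aOfS(s(a)+η)) − C₁(a)| ≤ L·Y(η)` and `|C₀(aOfS(s(a)+η)) − C₀(a)| ≤ L·Y(η)` for every `η` with `Y(η) ≤ r₀`
(`‖η‖ ≤ (5/2)·Y(η)`, `norm_le_shiftSize`). -/
theorem exists_calm_C1_C0_of_regular {a : Dir}
    (hopen : ∀ j : Fin 7, 0 < sParam a j.succ ∧ sParam a j.succ < sParam a 0) (hreg : Regular a) :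
    ∃ L r₀ : ℝ, 0 ≤ L ∧ 0 < r₀ ∧ ∀ η : Fin 8 → ℝ, shiftSize η ≤ r₀ →
      |C1 (aOfS (sParam a + η)) - C1 a| ≤ L * shiftSize η ∧
        |C0 (aOfS (sParam a + η)) - C0 a| ≤ L * shiftSize η := by
  obtain ⟨ρ, L, hρ, hL, hall⟩ := regular_stable hopen hreg
  refine ⟨5 / 2 * L, 2 / 5 * ρ, by positivity, by positivity, fun η hY => ?_⟩
  have hn : ‖sParam a + η - sParam a‖ ≤ 5 / 2 * shiftSize η := by
    rw [add_sub_cancel_left]; exact norm_le_shiftSize η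
  have hle : ‖sParam a + η - sParam a‖ ≤ ρ := hn.trans (by linarith)
  obtain ⟨-, -, h1, h0⟩ := hall _ hle
  have hL' : L * ‖sParam a + η - sParam a‖ ≤ 5 / 2 * L * shiftSize η :=
    (mul_le_mul_of_nonneg_left hn hL).trans_eq (by ring)
  exact ⟨h1.trans hL', h0.trans hL'⟩

/-! ### `γ`'s log-cusp on a ball — unconditionally at Regular directions -/

/-- **THE NEIGHBOURHOOD FORM OF `γ`'S LOG-CUSP AT A REGULAR DIRECTION (no Lipschitz hypothesis, no side condition).**
At a Regular open-box direction `a` with `Q = C₁ + δ₂₈ − Φ > 0`, for every period `T > 0` of the 28 forms: there are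
`C′` and `r > 0` — depending on `a`, `T` only — such that for EVERY displacement `η` with `0 < Y(η) ≤ r`:
`|γ(s(a)+η) − γ(a) − ((C₁−C₀)/Q²)·(cuspSlope a T η / T)·log(1/Y(η))| ≤ C′·Y(η)`.
So on the whole `Y`-ball the MODEL rate function is its value at the rational direction plus the cusp term with the
EXACT coefficient `(∂γ/∂Φ)·σ(η)/T`, `∂γ/∂Φ = (C₁−C₀)/Q² > 0`, up to `O(Y(η))` with ONE constant — P2 g23's ray
statement `gamma_logCusp_of_regular_cuspSlope` made uniform in the direction. This ball is Lemma B's coherence ball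
(intersected with g23's stability ball), not S-E's covering ball; S-E stays CONJECTURED; no radius or constant at a
named direction is asserted. -/
theorem gamma_logCusp_nhds_of_regular {a : Dir}
    (hopen : ∀ j : Fin 7, 0 < sParam a j.succ ∧ sParam a j.succ < sParam a 0) (hreg : Regular a)
    (hQ : 0 < C1 a + delta28 a - phi30 a) {T : ℝ} (hT : 0 < T)
    (hper : ∀ k : Fin 28, ∃ z : ℤ, T * h28 a k = z) :
    ∃ C' r : ℝ, 0 < r ∧ ∀ η : Fin 8 → ℝ, 0 < shiftSize η → shiftSize η ≤ r →
      |gamma (aOfS (sParam a + η)) - gamma a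
        - (C1 a - C0 a) / (C1 a + delta28 a - phi30 a) ^ 2 * (cuspSlope a T η / T)
          * Real.log (1 / shiftSize η)| ≤ C' * shiftSize η := by
  obtain ⟨L, r₀, hL, hr₀, hcalm⟩ := exists_calm_C1_C0_of_regular hopen hreg
  obtain ⟨C', r, hr, h⟩ := gamma_logCusp_nhds_of_lipschitz (BZBox_of_openBox hopen) (h28_pos_of_openBox hopen)
    hT hper hQ hL hr₀ (fun η hY => (hcalm η hY).1) (fun η hY => (hcalm η hY).2)
  obtain ⟨r₁, hr₁, hbox⟩ := BZBox_perturb_of_shiftSize_le hopen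
  exact ⟨C', min r r₁, lt_min hr hr₁, fun η hY hYr =>
    h η hY (hYr.trans (min_le_left _ _)) (hbox η (hYr.trans (min_le_right _ _)))⟩

/-- **`γ` HAS AN `Y·log(1/Y)` MODULUS AT A REGULAR DIRECTION** (quantitative form of P2 g23's
`continuousAt_gamma_of_regular` on the coherence ball): at a Regular open-box direction with `Q > 0`, for every period
`T`, there are `C′`, `r > 0` with `|γ(s(a)+η) − γ(a)| ≤ (28·(C₁−C₀)/Q²)·Y(η)·log(1/Y(η)) + C′·Y(η)` for every `η`
with `0 < Y(η) ≤ r` (`|σ(η)| ≤ 28·T·Y(η)`). No constant at a named direction is asserted. -/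
theorem abs_gamma_sub_le_of_regular {a : Dir}
    (hopen : ∀ j : Fin 7, 0 < sParam a j.succ ∧ sParam a j.succ < sParam a 0) (hreg : Regular a)
    (hQ : 0 < C1 a + delta28 a - phi30 a) {T : ℝ} (hT : 0 < T)
    (hper : ∀ k : Fin 28, ∃ z : ℤ, T * h28 a k = z) :
    ∃ C' r : ℝ, 0 < r ∧ ∀ η : Fin 8 → ℝ, 0 < shiftSize η → shiftSize η ≤ r →
      |gamma (aOfS (sParam a + η)) - gamma a|
        ≤ 28 * ((C1 a - C0 a) / (C1 a + delta28 a - phi30 a) ^ 2) * shiftSize η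
            * Real.log (1 / shiftSize η) + C' * shiftSize η := by
  have hpos := h28_pos_of_openBox hopen
  obtain ⟨C', r, hr, h⟩ := gamma_logCusp_nhds_of_regular hopen hreg hQ hT hper
  refine ⟨C', min r 1, lt_min hr one_pos, fun η hY hYr => ?_⟩
  have hmain := h η hY (hYr.trans (min_le_left _ _))
  have hκ : 0 ≤ (C1 a - C0 a) / (C1 a + delta28 a - phi30 a) ^ 2 :=
    div_nonneg (sub_nonneg.mpr (C0_lt_C1_of_regular hreg).le) (sq_nonneg _)
  have hL : 0 ≤ Real.log (1 / shiftSize η) :=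
    Real.log_nonneg ((one_le_div hY).mpr (hYr.trans (min_le_right _ _)))
  have hσ : |cuspSlope a T η / T| ≤ 28 * shiftSize η := by
    rw [abs_div, abs_of_pos hT, div_le_iff₀ hT]
    have := abs_cuspSlope_le_shiftSize hpos hT hper η
    linarith
  have hcusp : |(C1 a - C0 a) / (C1 a + delta28 a - phi30 a) ^ 2 * (cuspSlope a T η / T)
      * Real.log (1 / shiftSize η)|
      ≤ 28 * ((C1 a - C0 a) / (C1 a + delta28 a - phi30 a) ^ 2) * shiftSize η
          * Real.log (1 / shiftSize η) := by
    rw [abs_mul, abs_mul, abs_of_nonneg hκ, abs_of_nonneg hL]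
    have := mul_le_mul_of_nonneg_left hσ hκ
    have := mul_le_mul_of_nonneg_right this hL
    linarith
  calc |gamma (aOfS (sParam a + η)) - gamma a|
      = |(gamma (aOfS (sParam a + η)) - gamma a
          - (C1 a - C0 a) / (C1 a + delta28 a - phi30 a) ^ 2 * (cuspSlope a T η / T)
            * Real.log (1 / shiftSize η))
          + (C1 a - C0 a) / (C1 a + delta28 a - phi30 a) ^ 2 * (cuspSlope a T η / T)
            * Real.log (1 / shiftSize η)| := by rw [sub_add_cancel]
    _ ≤ _ := abs_add_le _ _
    _ ≤ C' * shiftSize η + 28 * ((C1 a - C0 a) / (C1 a + delta28 a - phi30 a) ^ 2) * shiftSize η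
          * Real.log (1 / shiftSize η) := add_le_add hmain hcusp
    _ = _ := by ring

end Summit.KontsevichZagierPeriods.Zeta5Search.Barrier.ConeGamma

end
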